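import Summits.CriticalPhenomena.CardyFormulaZ2.Theorems.CardyComplexConeSLESixFamiliesGiveCardyDefs
import Literature.Probability.RandomPlanarGeometry.CrossRatioContinuity
import Literature.Topology.PlaneTopology.Crosscut

/-!
# Stub `stub_modulusContinuity` of line `collar-touch-sandwich`
# (crux `SLESixFamiliesGiveCardy`, stmt-CriticalPhenomena-9654)

STATEMENT G of the definitions module
`Theorems/CardyComplexConeSLESixFamiliesGiveCardyDefs.lean` — **continuity of the conformal
modulus** in the `ε`-form with a re-basing shift: for every conformal rectangle `R` with
uniformizing datum `(φ, x)` and every `θ > 0` there is `ε > 0` such that every conformal rectangle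
`Q` whose boundary loop is uniformly `ε`-close to the re-based loop `s ↦ R.boundary (s + c)` and
whose mark parameters are `ε`-close after the same shift has all its uniformizing data `(φ', x')`
with `|crossRatio x' - crossRatio x| ≤ θ`.

Proof.  The tree already holds the SEQUENTIAL, un-shifted form as a corollary of Radó's theorem:
`ConformalRectangle.tendsto_crossRatio_of_tendsto_mark` (`CrossRatioContinuity.lean`: boundary
loops converge uniformly as parametrised loops and mark parameters converge ⇒ cross-ratios of
arbitrary uniformizing data converge).  We reduce to it by RE-BASING (a local construction in
`tendsto_crossRatio_of_rebase`): a marked domain `D` and a shift `e` with all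
`D.mark i - e ∈ [0, 1)` give the marked domain with boundary loop `s ↦ D.boundary (s + e)` and
marks `D.mark i - e`; it has the same carrier and the same marked POINTS, hence the same
uniformizing data.  Arguing by contradiction,
a failing `θ` yields rectangles `Q n`, shifts `c n` and data `(φ' n, x' n)` at closeness
`ε n = min (1/(n+1)) (g/4)`, `g = R.mark 0 + 1 - R.mark 3 > 0` the cyclic gap of the marks of `R`,
with `θ < |crossRatio (x' n) - crossRatio x|`.  With the midpoint shift
`c' = (R.mark 0 + R.mark 3 - 1)/2` the numbers `R.mark i - c'` lie in `[g/2, 1 - g/2]`, so `R`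
re-based by `c'` and `Q n` re-based by `c' - c n` are conformal rectangles (marks in `(0, 1)`),
their loops are uniformly `1/(n+1)`-close and their marks `1/(n+1)`-close, with NO shift left;
the tree's theorem gives `crossRatio (x' n) → crossRatio x`, a contradiction.
-/

noncomputable section

open Set Filter Topology Metric
open UpperHalfPlane (upperHalfPlaneSet)
open Literature.Probability.RandomPlanarGeometry

namespace Summit.CriticalPhenomena.CardyFormulaZ2.Cruxes.SLESixFamiliesGiveCardy.CollarTouchSandwich

/-! ### The sequential statement after re-basing -/

/-- **Cross-ratios converge along re-based rectangles.**  If the loops of `Q n` are uniformly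
`δ n`-close to the loop of `R` shifted by `c n`, the marks are `δ n`-close after the same shift,
`δ n → 0`, and a single shift `c'` puts all `R.mark i - c'` and all `(Q n).mark i - (c' - c n)`
in `[0, 1)`, then the cross-ratios of arbitrary uniformizing data of `Q n` converge to that of
`R`.  RE-BASING (the local construction `rb`): a marked domain `D` and a shift `e` with all
`D.mark i - e ∈ [0, 1)` give the conformal rectangle with the same carrier, boundary loop
`s ↦ D.boundary (s + e)` (continuous, `1`-periodic, injective on a period by
`JordanDomain.injOn_boundary_Ico`, of the same range) and marks `D.mark i - e`; it has the same
marked POINTS, hence the same uniformizing data (`IsUniformizing` only sees the carrier and the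
marked points).  The loops and marks of `R` re-based by `c'` and of `Q n` re-based by `c' - c n`
converge with NO shift, and `ConformalRectangle.tendsto_crossRatio_of_tendsto_mark`
(`CrossRatioContinuity.lean`, Radó's theorem) applies. -/
theorem tendsto_crossRatio_of_rebase {Q : ℕ → ConformalRectangle} {R : ConformalRectangle}
    {c δ : ℕ → ℝ} {c' : ℝ} (hδ : Tendsto δ atTop (𝓝 0))
    (hb : ∀ n s, dist ((Q n).boundary s) (R.boundary (s + c n)) ≤ δ n)
    (hm : ∀ n i, |(Q n).mark i + c n - R.mark i| ≤ δ n)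
    (hR : ∀ i, R.mark i - c' ∈ Ico (0 : ℝ) 1)
    (hQ : ∀ n i, (Q n).mark i - (c' - c n) ∈ Ico (0 : ℝ) 1)
    {ψ : ∀ n, ConformalEquiv upperHalfPlaneSet (Q n).carrier} {y : ℕ → Fin 4 → ℝ}
    (hψ : ∀ n, (Q n).IsUniformizing (ψ n) (y n))
    {φ : ConformalEquiv upperHalfPlaneSet R.carrier} {x : Fin 4 → ℝ} (hφ : R.IsUniformizing φ x) :
    Tendsto (fun n ↦ crossRatio (y n)) atTop (𝓝 (crossRatio x)) := by
  -- re-basing a conformal rectangle by a shift `e` (same carrier, same marked points)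
  let rb : ∀ (D : ConformalRectangle) (e : ℝ), (∀ i, D.mark i - e ∈ Ico (0 : ℝ) 1) →
      ConformalRectangle := fun D e h ↦
    { carrier := D.carrier
      boundary := fun s ↦ D.boundary (s + e)
      isOpen := D.isOpen
      isBounded := D.isBounded
      isConnected := D.isConnected
      continuous_boundary := D.continuous_boundary.comp (continuous_id.add continuous_const)
      periodic_boundary := fun s ↦ by
        show D.boundary (s + 1 + e) = D.boundary (s + e)
        rw [add_right_comm]
        exact D.periodic_boundary _
      injOn_boundary := by
        intro s hs t ht hst
        have h' := D.toJordanDomain.injOn_boundary_Ico e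
          ⟨by linarith [hs.1], by linarith [hs.2]⟩ ⟨by linarith [ht.1], by linarith [ht.2]⟩ hst
        linarith
      range_boundary := by
        rw [← D.range_boundary]
        ext z
        constructor
        · rintro ⟨s, rfl⟩
          exact ⟨s + e, rfl⟩
        · rintro ⟨s, rfl⟩
          exact ⟨s - e, by simp⟩
      mark := fun i ↦ D.mark i - e
      strictMono_mark := fun _ _ hij ↦ sub_lt_sub_right (D.strictMono_mark hij) e
      mark_mem := h }
  -- uniformizing data of `D` are uniformizing data of the re-based rectangle
  have hunif : ∀ (D : ConformalRectangle) (e : ℝ) (h : ∀ i, D.mark i - e ∈ Ico (0 : ℝ) 1)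
      (φ : ConformalEquiv upperHalfPlaneSet D.carrier) (x : Fin 4 → ℝ),
      D.IsUniformizing φ x → (rb D e h).IsUniformizing φ x := fun D e h φ x hφ ↦
    ⟨hφ.1, fun i ↦ by
      have hpt : (rb D e h).pt i = D.pt i := by
        show D.boundary (D.mark i - e + e) = D.pt i
        rw [sub_add_cancel]
        rfl
      rw [hpt]
      exact hφ.2 i⟩
  have hδ' : ∀ ε : ℝ, 0 < ε → ∀ᶠ n in atTop, δ n < ε := fun ε hε ↦
    (Metric.tendsto_nhds.1 hδ) ε hε |>.mono fun n hn ↦ by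
      rw [Real.dist_eq, sub_zero] at hn
      exact (le_abs_self _).trans_lt hn
  -- the re-based loops converge uniformly, with no shift
  have hJ : TendstoUniformly (fun n ↦ (rb (Q n) (c' - c n) (hQ n)).boundary)
      (rb R c' hR).boundary atTop := by
    rw [Metric.tendstoUniformly_iff]
    intro ε hε
    filter_upwards [hδ' ε hε] with n hn s
    show dist (R.boundary (s + c')) ((Q n).boundary (s + (c' - c n))) < ε
    rw [dist_comm]
    have h1 := hb n (s + (c' - c n))
    rw [show s + (c' - c n) + c n = s + c' by ring] at h1
    exact h1.trans_lt hn
  -- the re-based marks converge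
  have hmk : ∀ i, Tendsto (fun n ↦ (rb (Q n) (c' - c n) (hQ n)).mark i) atTop
      (𝓝 ((rb R c' hR).mark i)) := fun i ↦ by
    rw [Metric.tendsto_nhds]
    intro ε hε
    filter_upwards [hδ' ε hε] with n hn
    show dist ((Q n).mark i - (c' - c n)) (R.mark i - c') < ε
    rw [Real.dist_eq,
      show (Q n).mark i - (c' - c n) - (R.mark i - c') = (Q n).mark i + c n - R.mark i by ring]
    exact (hm n i).trans_lt hn
  exact ConformalRectangle.tendsto_crossRatio_of_tendsto_mark hJ hmk (fun n ↦ ψ n) y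
    (fun n ↦ hunif (Q n) _ (hQ n) (ψ n) (y n) (hψ n)) φ x (hunif R c' hR φ x hφ)

/-! ### The registered stub -/

/-- STATEMENT G — **continuity of the conformal modulus** (`ModulusContinuity`): for every
conformal rectangle `R` with uniformizing datum `(φ, x)` and every `θ > 0` there is `ε > 0` such
that every conformal rectangle `Q` with `dist (Q.boundary s) (R.boundary (s + c)) ≤ ε` for all `s`
and `|Q.mark i + c - R.mark i| ≤ ε` for all `i` (some shift `c`) has all its uniformizing data
`(φ', x')` with `|crossRatio x' - crossRatio x| ≤ θ`.  By contradiction from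
`tendsto_crossRatio_of_rebase` at closeness `min (1/(n+1)) (g/4)`, `g` the cyclic gap
`R.mark 0 + 1 - R.mark 3`, with the midpoint shift `c' = (R.mark 0 + R.mark 3 - 1)/2`. -/
theorem stub_modulusContinuity : ModulusContinuity := by
  intro R φ x hφ θ hθ
  by_contra H
  push Not at H
  have h0 := (R.mark_mem 0).1
  have h3 := (R.mark_mem 3).2
  set g : ℝ := R.mark 0 + 1 - R.mark 3 with hg
  have hg0 : 0 < g := by simp only [hg]; linarith
  set c' : ℝ := (R.mark 0 + R.mark 3 - 1) / 2 with hc'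
  have hε : ∀ n : ℕ, 0 < min (1 / ((n : ℝ) + 1)) (g / 4) := fun n ↦
    lt_min (by positivity) (by linarith)
  choose Q c hb hm φ' x' hφ' hfar using fun n : ℕ ↦ H _ (hε n)
  have hlo : ∀ i : Fin 4, R.mark 0 ≤ R.mark i := fun i ↦ R.strictMono_mark.monotone (Fin.zero_le i)
  have hhi : ∀ i : Fin 4, R.mark i ≤ R.mark 3 := fun i ↦ R.strictMono_mark.monotone (Fin.le_last i)
  have hR : ∀ i, R.mark i - c' ∈ Ico (0 : ℝ) 1 := fun i ↦ by
    have := hlo i; have := hhi i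
    constructor <;> simp only [hc'] <;> linarith
  have hQ : ∀ n i, (Q n).mark i - (c' - c n) ∈ Ico (0 : ℝ) 1 := fun n i ↦ by
    have h4 : |(Q n).mark i + c n - R.mark i| ≤ g / 4 := (hm n i).trans (min_le_right _ _)
    rw [abs_le] at h4
    have := hlo i; have := hhi i
    constructor <;> simp only [hc'] <;> linarith
  have hδ : Tendsto (fun n : ℕ ↦ min (1 / ((n : ℝ) + 1)) (g / 4)) atTop (𝓝 0) := by
    refine squeeze_zero (fun n ↦ (hε n).le) (fun n ↦ min_le_left _ _) ?_
    exact tendsto_one_div_add_atTop_nhds_zero_nat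
  have hlim := tendsto_crossRatio_of_rebase hδ hb hm hR hQ hφ' hφ
  obtain ⟨n, hn⟩ := ((Metric.tendsto_nhds.1 hlim) θ hθ).exists
  rw [Real.dist_eq] at hn
  exact lt_asymm hn (hfar n)

end Summit.CriticalPhenomena.CardyFormulaZ2.Cruxes.SLESixFamiliesGiveCardy.CollarTouchSandwich

end
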